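import Summits.ValiantsHypothesis.ValiantsHypothesis.Theorems.KPlusLogSqLawTropicalBThreeFiveBound3

/-!
# Route «KPlusLogSqLaw», crux `TropicalB` (stmt-ValiantsHypothesis-19771) — certificate kit for the `(3,5)` row, part 5:
# the covering lemma with `k` missing histograms — «a family of refuted patterns avoided by every `k` histograms ⇒ `n ≤ 33 − k`»

HONEST FRAMING.  Helper toward the registered stubs `stub_tropThin` / `stub_tropFat` of `Cruxes/TropicalB/Lines/birth.lean` (crux `TropicalB`,
item stmt-ValiantsHypothesis-19771; cell `pub-symmetroid`, seat val-sym-trop-p3 g10, 2026-08-28; `--supports … --as helper`).  Generic MACHINERY ONLY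
(sequel of `…ThreeFiveBound3`, whose `leD_31_of_family` is the case `k = 2`): no census value is claimed.  Purpose: per-cell certificates SHARPER
than `≤ 31` — the seat's located sweep (memo HOME/val-sym-trop-p3/g10/FINDINGS §2) says the two order-level laws cap most exponent order types of the
`(3,5)` row at `31` or fewer TERMS (`n ≤ 30`), which a kernel certificate expresses with a family avoided by every THREE histograms (`k = 3`).
Nothing here bears on `TropicalB` in its window, `WeakLifting`, DoorA26 / DoorA34, `MatrixDescartes` (stmt-ValiantsHypothesis-18050) or VP ≠ VNP.

CONTENT.
* `exists_missing_le` — an unsigned dominant chain of a `(3,5)` design with `n + 1 ≥ 35 − k` terms carries every histogram outside the range of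
  some `f : Fin k → Sym (Fin 5) 3` (its at most `k` missing histograms, padded).
* `leD_of_family_k` — if every entry of `F` is refuted by `search31` under its own relation lists (true for the monotone `d`, patterns slope-ordered)
  and every `k`-tuple of histograms is avoided by some entry's pattern, then `n ≤ 33 − k` for every unsigned dominant chain of a `(3,5)` design with
  exponents `d` (for explicit `F` and small `k` the covering hypothesis is a kernel `decide` over `Fin k → Sym (Fin 5) 3`).
[this cell]
-/

set_option linter.dupNamespace false
set_option autoImplicit false

namespace Summit.ValiantsHypothesis.ValiantsHypothesis.Theorems.KPlusLogSqLaw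

open Summit.ValiantsHypothesis.ValiantsHypothesis.Theorems.MatrixDescartes.Negative
open Summit.ValiantsHypothesis.ValiantsHypothesis.Theorems.LacunarySymmetroidMatrixDescartes.TropicalCensus
open Finset ForbiddenPatterns

namespace ThreeFive

/-- an unsigned chain of a `(3,5)` design with at least `35 − k` terms carries every histogram outside the range of some `k`-tuple. -/
theorem exists_missing_le {d : Fin 5 → ℕ} {v ε : Fin 3 → Fin 3 → Fin 5 → ℤ} {n : ℕ} {θ : Fin (n + 1) → ℤ}
    {p : Fin (n + 1) → Equiv.Perm (Fin 3) × (Fin 3 → Fin 5)} (hθ : StrictMono θ)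
    (hdom : ∀ k, IsDominant d v ε (θ k) (p k)) (hne : ∀ k : Fin n, p k.castSucc ≠ p k.succ) (k : ℕ) (hn : 34 ≤ n + k) :
    (StrictMono fun j => slope d (p j)) ∧
      ∃ f : Fin k → Sym (Fin 5) 3, ∀ s : Sym (Fin 5) 3, (∀ i, s ≠ f i) → ∃ j, classSym (p j) = s := by
  classical
  have hsm : StrictMono fun j => slope d (p j) := by
    rw [Fin.strictMono_iff_lt_succ]
    intro j
    exact slope_lt_of_dominant d v ε (hθ Fin.castSucc_lt_succ) (hne j) (hdom _) (hdom _)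
  have hinj : Function.Injective fun j => classSym (p j) := by
    intro j j' h
    apply hsm.injective
    simp only
    rw [slope_eq_of_classSym, slope_eq_of_classSym]
    exact congrArg (fun M : Sym (Fin 5) 3 => ((M : Multiset (Fin 5)).map fun l => (d l : ℤ)).sum) h
  refine ⟨hsm, ?_⟩
  set S : Finset (Sym (Fin 5) 3) := univ.image fun j => classSym (p j) with hS
  have hcardS : S.card = n + 1 := by
    rw [hS, card_image_of_injective _ hinj, card_univ, Fintype.card_fin]
  have hcard : Fintype.card (Sym (Fin 5) 3) = 35 := by
    rw [Sym.card_sym_eq_multichoose, Fintype.card_fin, Nat.multichoose_eq]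
    decide
  have hle35 : n + 1 ≤ 35 := by
    have := card_le_univ S
    rw [hcardS, hcard] at this
    exact this
  have hcompl : Sᶜ.card ≤ k := by
    rw [card_compl, hcard, hcardS]
    omega
  have hmemS : ∀ s, s ∈ S ↔ ∃ j, classSym (p j) = s := fun s => by simp [hS]
  -- pad the list of missing histograms to a `k`-tuple
  set l : List (Sym (Fin 5) 3) := Sᶜ.toList with hl
  have hlen : l.length ≤ k := by rw [hl, length_toList]; exact hcompl
  let s₀ : Sym (Fin 5) 3 := classSym (p 0)
  refine ⟨fun i => if h : (i : ℕ) < l.length then l.get ⟨i, h⟩ else s₀, fun s hs => ?_⟩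
  by_contra hnot
  have hsc : s ∈ Sᶜ := by
    rw [mem_compl]
    exact fun h => hnot ((hmemS s).mp h)
  have hsl : s ∈ l := by rw [hl, mem_toList]; exact hsc
  obtain ⟨i, hi⟩ := List.get_of_mem hsl
  have hik : (i : ℕ) < k := lt_of_lt_of_le i.isLt hlen
  have := hs ⟨i, hik⟩
  apply this
  simp only [i.isLt, dif_pos]
  exact hi.symm

/-- **COVERING LEMMA WITH `k` MISSING HISTOGRAMS — `n ≤ 33 − k`.**  If every entry of `F` is refuted by `search31` under ITS OWN relation lists,
all true for the monotone `d`, its pattern slope-ordered by `d`, and every `k`-tuple of histograms is avoided by some entry's pattern, then every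
unsigned dominant chain of a `(3,5)` design with exponents `d` has at most `33 − k` breakpoints (a chain with `34 − k` breakpoints has `35 − k`
terms, misses at most `k` histograms, and so carries a whole pattern).  `k = 2` is `leD_31_of_family`. -/
theorem leD_of_family_k (d : Fin 5 → ℕ) (v ε : Fin 3 → Fin 3 → Fin 5 → ℤ) (k : ℕ) (F : List Entry)
    (hsearch : ∀ e ∈ F, search31 e.1 e.2.1 e.2.2.1 (e.2.2.2.map Prod.snd) = true)
    (harr : ∀ e ∈ F, ∀ q ∈ e.2.2.2, ∀ c : Fin 3 → Fin 5, (univ.val.map c : Multiset (Fin 5)) = (q.1 : Multiset (Fin 5)) → c ∈ q.2)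
    (hcover : ∀ f : Fin k → Sym (Fin 5) 3, ∃ e ∈ F, ∀ q ∈ e.2.2.2, ∀ i, q.1 ≠ f i)
    (hmono : Monotone d)
    (hR2 : ∀ e ∈ F, ∀ r ∈ e.1, d r.1.1 + d r.1.2 < d r.2.1 + d r.2.2)
    (hR3 : ∀ e ∈ F, ∀ r ∈ e.2.1, d r.1.1 + d r.1.2.1 + d r.1.2.2 < d r.2.1 + d r.2.2.1 + d r.2.2.2)
    (hR6 : ∀ e ∈ F, ∀ r ∈ e.2.2.1, s3 d r.1.1 + s3 d r.1.2 < s3 d r.2.1 + s3 d r.2.2)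
    (hord : ∀ e ∈ F, e.2.2.2.IsChain (fun q q' => symSlope d q.1 < symSlope d q'.1))
    (n : ℕ) (θ : Fin (n + 1) → ℤ) (p : Fin (n + 1) → Equiv.Perm (Fin 3) × (Fin 3 → Fin 5)) (hθ : StrictMono θ)
    (hdom : ∀ j, IsDominant d v ε (θ j) (p j)) (hne : ∀ j : Fin n, p j.castSucc ≠ p j.succ) : n ≤ 33 - k := by
  classical
  by_contra hn
  push Not at hn
  obtain ⟨hsm, f, hf⟩ := exists_missing_le hθ hdom hne k (by omega)
  obtain ⟨e, he, havoid⟩ := hcover f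
  have hposq : ∀ q ∈ e.2.2.2, ∃ j, classSym (p j) = q.1 := fun q hq => hf q.1 (havoid q hq)
  let pos : Sym (Fin 5) 3 × List (Fin 3 → Fin 5) → Fin (n + 1) := fun q =>
    if h : ∃ j, classSym (p j) = q.1 then Classical.choose h else 0
  have hpos : ∀ q ∈ e.2.2.2, classSym (p (pos q)) = q.1 := by
    intro q hq
    simp only [pos, dif_pos (hposq q hq)]
    exact Classical.choose_spec (hposq q hq)
  exact false_of_search31 d v ε e.1 e.2.1 e.2.2.1 hmono (hR2 e he) (hR3 e he) (hR6 e he) e.2.2.2 (hsearch e he) (harr e he)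
    (hord e he) θ p hθ hdom hsm pos hpos

end ThreeFive

end Summit.ValiantsHypothesis.ValiantsHypothesis.Theorems.KPlusLogSqLaw
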